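import Summits.QuantumFields.YangMills.Theorems.BalabanLadderIRTypExcessSparse
import Summits.QuantumFields.YangMills.Theorems.BalabanLadderIRTypBallSparseScales
import HarnessLib

/-!
# The torus anchor (clause (iii)) of the excess-sparse factor `Typ_xs`, its scales, and its composition with bulk factors

Support file (seat ym-infvol-p3, fleet R136 (i); crux `IR` = stmt-QuantumFields-19354, registered line «af-pincer-U»
(owner R59-U, `line-af-pincer-U.reg.lean` fc8c6b10a3fbcbe2, stub `stub_onsetU : OnsetMixingTypicalUKP`; clause (iii) of
`TypShellCondUKP` = clause (iii_T) verbatim); count-neutral helper).  The working class of the line's card (rev 5/6,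
CONTAGION-NOTE-g6 §3, owner R59 (C)) has the LARGE-FIELD factor `typExcessSparse ρ w t₀ R E₀ c`
(`…IRTypExcessSparse`: in every sup-norm `R`-ball the excess action `∑ (s_q - t₀)₊` of the cell's own plaquettes is
`≤ E₀`; scales `t₀ = K log β / β`, `R = R₀`, `E₀` constant).  The note records its torus supplier as «(J) torus (iii_T)
— chessboard over disjoint cells [heur arithmetic, decls in tree]».  This file makes it [lean]:

* **`torusAnchor_typExcessSparse`** — clause (iii) for `Typ := typExcessSparse r.ρ w t₀ R E₀` (`t₀, E₀ ≥ 0`) on every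
  odd torus `2S+1 ≥ 4b`, every finite `F` inside `[-S, S]⁴`:
  `μ_{2S+1,β} {V | ∀ c ∈ F, torusLift V ∉ Typ_xs c} ≤ ofReal (δ_xs ^ #F)`,
  `δ_xs = (2b)⁴ m · 2^((4R+1)⁴ m) · m · exp (-λ E₀ / m² + (4R+1)⁴ m (K₀ + D₁ log β) / m)`, `m = 6`, `0 ≤ λ ≤ β` free,
  `K₀, D₁` the volume-free constants of `measureReal_forall_le_cellAction_le_pow_rep` (an atypical cell has a member
  of `excessChoices` with total action `> E₀`; union over `F.pi excessChoices` of the hereditary chessboard rarity);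
* **`torusAnchor_typExcessSparse_eventually`** — at the note's scales (`R = R₀` and `E₀` constant, any threshold
  `t₀ ≥ 0`, meshes with `log b ≤ C β`) and `λ = β`: if `144 C < E₀` then for every `δ > 0` there is `β₂` beyond which
  the clause holds with budget `δ`, uniformly in `b`, `w`, `t₀` — the quantifier order of `OnsetMixingTypical[UKP]`.
  The rate of this supplier is `β E₀ / 36` against the `e^{4Cβ}` ball positions of a cell (the note's «typicality:
  `E₀ > 4 c_ξ / λ`» with this file's `λ`-constant `1/36`; a sharper chessboard constant is possible but not needed);
* **`torusJointRarity_typExcessSparse_inter`** — clause (iii) for `typExcessSparse ∩ Typ₂` with budget `δ_xs + δ₂`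
  for any cell-local measurable `Typ₂` with single-cell sup-`ζ` kernel rarity `δ₂` (mixed torus upgrade
  `IRRarityUpgrade.torusJointRarity_inter`).

Everything here is proved (no `sorry`, no new axioms).  NOT covered (honest): the factor's kernel-level rarity
((ii) in UKP form — CONTAGION-NOTE §3.4 (A), the R46.3 debt: local moderate deviations of the excess functional under
kernels with forcing boundary data) and (i); nothing here bears on the mass gap or Clay.
-/

set_option autoImplicit false

noncomputable section

open MeasureTheory Finset
open Literature.MathematicalPhysics
open Literature.MathematicalPhysics.QuantumFieldTheory Literature.MathematicalPhysics.QuantumLattice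
open Summit.QuantumFields.YangMills.Cruxes.IR.Tempered (cellEdges regionEdges)

namespace Summit.QuantumFields.YangMills.Theorems.OddTorusChessboard

variable {G : Type} [Group G] [TopologicalSpace G] [IsTopologicalGroup G] [CompactSpace G]
  [MeasurableSpace G] [BorelSpace G]

omit [TopologicalSpace G] [IsTopologicalGroup G] [CompactSpace G] [MeasurableSpace G] [BorelSpace G] in
/-- The torus cost of a projected plaquette is the plaquette action read on the periodic lift. -/
theorem plaquetteCost_projPlaq_eq_plaqAction {N : ℕ} (ρ : G →* Matrix (Fin N) (Fin N) ℂ) (S : ℕ)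
    (V : GaugeConfig 4 (2 * S + 1) G) (q : ZdPlaquette 4) :
    plaquetteCost ρ V (projPlaq (2 * S + 1) q) = plaqAction ρ q (torusLift (2 * S + 1) V) :=
  plaquetteCost_projPlaq ρ S V q

/-! ### §1 The torus anchor for the excess-sparse factor -/

/-- **The torus anchor (clause (iii) of `TypShellCond[UKP]`) for the excess-sparse factor.**  For every lattice
representation `r : LatticeRep G` there are `K₀, D₁` such that for all `β ≥ 1`, `0 ≤ λ ≤ β`, meshes `b ≥ 1`,
thresholds `t₀ ≥ 0`, radii `R`, budgets `E₀ ≥ 0`, every mesh-`b` grid `w`, every odd torus `2S+1 ≥ 4b` and every finite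
set `F` of cells inside `[-S, S]⁴`:
`μ_{2S+1,β} {V | ∀ c ∈ F, torusLift V ∉ typExcessSparse r.ρ w t₀ R E₀ c} ≤ ofReal (δ_xs ^ #F)`,
`δ_xs = (2b)⁴ m · 2^((4R+1)⁴ m) · m · exp (-λ E₀ / m² + ((4R+1)⁴ m) (K₀ + D₁ log β) / m)`. -/
theorem torusAnchor_typExcessSparse (r : LatticeRep G) :
    ∃ K₀ : ℝ, ∃ D₁ : ℕ, ∀ (β : ℝ), 1 ≤ β → ∀ (lam : ℝ), 0 ≤ lam → lam ≤ β → ∀ (b : ℕ), 1 ≤ b →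
      ∀ (t₀ : ℝ), 0 ≤ t₀ → ∀ (R : ℕ) (E₀ : ℝ), 0 ≤ E₀ → ∀ (w : Fin 4 → ℤ → ℤ),
        (∀ i j, w i j + ((b : ℕ) : ℤ) ≤ w i (j + 1) ∧ w i (j + 1) ≤ w i j + 2 * ((b : ℕ) : ℤ)) →
          ∀ S : ℕ, 4 * b ≤ 2 * S + 1 → ∀ F : Finset (Fin 4 → ℤ),
            (∀ c ∈ F, ∀ i, -(S : ℤ) ≤ w i (c i) ∧ w i (c i + 1) ≤ (S : ℤ) + 1) →
              (wilsonMeasure (d := 4) (L := 2 * S + 1) r.ρ β)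
                  {V : GaugeConfig 4 (2 * S + 1) G |
                    ∀ c ∈ F, torusLift (2 * S + 1) V ∉ typExcessSparse r.ρ w t₀ R E₀ c} ≤
                ENNReal.ofReal
                  (((((2 * b) ^ 4 * Fintype.card (Orient 4) : ℕ) : ℝ) *
                      (2 : ℝ) ^ ((4 * R + 1) ^ 4 * Fintype.card (Orient 4)) *
                    ((Fintype.card (Orient 4) : ℝ) *
                      Real.exp (-(lam * E₀) / (Fintype.card (Orient 4) : ℝ) ^ 2 +
                        (((4 * R + 1) ^ 4 * Fintype.card (Orient 4) : ℕ) : ℝ) * (K₀ + D₁ * Real.log β) /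
                          Fintype.card (Orient 4)))) ^ #F) := by
  classical
  obtain ⟨K₀, D₁, h⟩ := measureReal_forall_le_cellAction_le_pow_rep r
  refine ⟨K₀, D₁, fun β hβ lam hlam hlamβ b hb t₀ ht₀ R E₀ hE₀ w hw S hS F hin => ?_⟩
  have hL : Odd (2 * S + 1) := ⟨S, rfl⟩
  have hL3 : 3 ≤ 2 * S + 1 := by omega
  haveI := isProbabilityMeasure_wilsonMeasure (d := 4) (L := 2 * S + 1) (G := G) r.ρ r.continuous β
  set μ := wilsonMeasure (d := 4) (L := 2 * S + 1) (G := G) r.ρ β with hμ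
  obtain ⟨M, hM⟩ : ∃ M : ℕ, M = ((2 * b) ^ 4 * Fintype.card (Orient 4)) *
      2 ^ ((4 * R + 1) ^ 4 * Fintype.card (Orient 4)) := ⟨_, rfl⟩
  obtain ⟨δ₀, hδ₀⟩ : ∃ δ₀ : ℝ, δ₀ = (Fintype.card (Orient 4) : ℝ) *
      Real.exp (-(lam * E₀) / (Fintype.card (Orient 4) : ℝ) ^ 2 +
        (((4 * R + 1) ^ 4 * Fintype.card (Orient 4) : ℕ) : ℝ) * (K₀ + D₁ * Real.log β) /
          Fintype.card (Orient 4)) := ⟨_, rfl⟩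
  have hδ₀nn : 0 ≤ δ₀ := by rw [hδ₀]; positivity
  -- the torus plaquette families of a choice function and the corresponding events
  set Pf : (∀ c ∈ F, Finset (ZdPlaquette 4)) → (Fin 4 → ℤ) → Finset (Plaquette 4 (2 * S + 1)) :=
    fun f c => if hc : c ∈ F then (f c hc).image (projPlaq (2 * S + 1)) else ∅ with hPf
  set E : (∀ c ∈ F, Finset (ZdPlaquette 4)) → Set (GaugeConfig 4 (2 * S + 1) G) :=
    fun f => {V | ∀ c ∈ F, E₀ ≤ ∑ q ∈ Pf f c, plaquetteCost r.ρ V q} with hE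
  -- Step 1: the atypical event is covered by the events of the choice functions
  have hcover : {V : GaugeConfig 4 (2 * S + 1) G |
      ∀ c ∈ F, torusLift (2 * S + 1) V ∉ typExcessSparse r.ρ w t₀ R E₀ c} ⊆
        ⋃ f ∈ F.pi (excessChoices w R), E f := by
    intro V hV
    simp only [Set.mem_setOf_eq] at hV
    choose Q hQmem hQlarge using
      fun c (hc : c ∈ F) => exists_mem_excessChoices_of_notMem (G := G) r.ρ ht₀ hE₀ (hV c hc)
    refine Set.mem_iUnion₂.2 ⟨Q, Finset.mem_pi.2 fun c hc => hQmem c hc, ?_⟩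
    simp only [hE, Set.mem_setOf_eq]
    intro c hc
    obtain ⟨hQsub, -⟩ := card_le_of_mem_excessChoices (hQmem c hc)
    simp only [hPf, dif_pos hc]
    rw [Finset.sum_image fun q hq q' hq' hqq => projPlaq_injOn_box S
      (cellSites_subset_box (hin c hc) _ (fst_mem_cellSites_of_mem_cellPlaqs (hQsub hq)))
      (cellSites_subset_box (hin c hc) _ (fst_mem_cellSites_of_mem_cellPlaqs (hQsub hq'))) hqq]
    simp only [plaquetteCost_projPlaq_eq_plaqAction]
    exact (hQlarge c hc).le
  -- Step 2: each choice function's event is hereditarily rare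
  have hstep : ∀ f ∈ F.pi (excessChoices w R), μ (E f) ≤ ENNReal.ofReal (δ₀ ^ #F) := by
    intro f hf
    have hf' : ∀ c (hc : c ∈ F), f c hc ∈ excessChoices w R c := Finset.mem_pi.1 hf
    have hdisj : ∀ c ∈ F, ∀ c' ∈ F, c ≠ c' → Disjoint (Pf f c) (Pf f c') := by
      intro c hc c' hc' hcc
      simp only [hPf, dif_pos hc, dif_pos hc']
      rw [Finset.disjoint_left]
      intro q hq hq'
      obtain ⟨z, hz, rfl⟩ := Finset.mem_image.1 hq
      obtain ⟨z', hz', hzz⟩ := Finset.mem_image.1 hq'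
      have hzc : z ∈ cellPlaqs w c := (card_le_of_mem_excessChoices (hf' c hc)).1 hz
      have hz'c : z' ∈ cellPlaqs w c' := (card_le_of_mem_excessChoices (hf' c' hc')).1 hz'
      have hz1 := fst_mem_cellSites_of_mem_cellPlaqs hzc
      have hz'1 := fst_mem_cellSites_of_mem_cellPlaqs hz'c
      have heq : z' = z := projPlaq_injOn_box S (cellSites_subset_box (hin c' hc') _ hz'1)
        (cellSites_subset_box (hin c hc) _ hz1) hzz
      rw [heq] at hz'1
      exact Finset.disjoint_left.1 (disjoint_cellSites hw hcc) hz1 hz'1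
    have hn : ∀ c ∈ F, #(Pf f c) ≤ (4 * R + 1) ^ 4 * Fintype.card (Orient 4) := by
      intro c hc
      simp only [hPf, dif_pos hc]
      exact Finset.card_image_le.trans (card_le_of_mem_excessChoices (hf' c hc)).2
    have hmain := h hL hL3 β hβ lam hlam hlamβ F (Pf f) hdisj ((4 * R + 1) ^ 4 * Fintype.card (Orient 4)) hn E₀
    rw [← ofReal_measureReal, hδ₀]
    exact ENNReal.ofReal_le_ofReal hmain
  -- Step 3: the union bound
  have hcardpi : (#(F.pi (excessChoices w R)) : ℝ) ≤ (M : ℝ) ^ #F := by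
    rw [Finset.card_pi]
    have : ∏ c ∈ F, #(excessChoices w R c) ≤ ∏ _c ∈ F, M :=
      Finset.prod_le_prod' fun c _ => hM ▸ card_excessChoices_le hw R c
    rw [Finset.prod_const] at this
    exact_mod_cast this
  calc μ {V : GaugeConfig 4 (2 * S + 1) G | ∀ c ∈ F, torusLift (2 * S + 1) V ∉ typExcessSparse r.ρ w t₀ R E₀ c}
      ≤ μ (⋃ f ∈ F.pi (excessChoices w R), E f) := measure_mono hcover
    _ ≤ ∑ f ∈ F.pi (excessChoices w R), μ (E f) := measure_biUnion_finset_le _ _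
    _ ≤ ∑ _f ∈ F.pi (excessChoices w R), ENNReal.ofReal (δ₀ ^ #F) := Finset.sum_le_sum hstep
    _ = (#(F.pi (excessChoices w R)) : ENNReal) * ENNReal.ofReal (δ₀ ^ #F) := by
        rw [Finset.sum_const, nsmul_eq_mul]
    _ ≤ ENNReal.ofReal ((M : ℝ) ^ #F) * ENNReal.ofReal (δ₀ ^ #F) := by
        gcongr
        rw [← ENNReal.ofReal_natCast]
        exact ENNReal.ofReal_le_ofReal hcardpi
    _ = ENNReal.ofReal (((M : ℝ) * δ₀) ^ #F) := by
        rw [← ENNReal.ofReal_mul (by positivity), mul_pow]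
    _ = _ := by
        rw [hM, hδ₀]
        push_cast
        ring

/-! ### §2 The anchor at the note's scales, in the quantifier order of `OnsetMixingTypical[UKP]` -/

omit [TopologicalSpace G] [IsTopologicalGroup G] [CompactSpace G] [MeasurableSpace G] [BorelSpace G] in
/-- Arithmetic: with `η := E₀/36 - 4C > 0` and `a := n (D₁/6) ≥ 0`, for `β` beyond an explicit threshold,
`96 e^{4Cβ} · P · 6 exp (-β E₀/36 + n (K₀ + D₁ log β)/6) ≤ δ` (`P = 2^n`, `n = 6 (4R₀+1)⁴`). -/
theorem excess_budget_le (K₀ : ℝ) (D₁ : ℕ) (n : ℕ) {C E₀ δ β : ℝ} (hE : 144 * C < E₀) (hδ : 0 < δ) (hβ1 : 1 ≤ β)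
    (hβ : (2 / (E₀ / 36 - 4 * C)) * (Real.log (96 * (2 : ℝ) ^ n * 6 / δ) + (n : ℝ) * K₀ / 6 +
      (n : ℝ) * D₁ / 6 * Real.log (2 * ((n : ℝ) * D₁ / 6) / (E₀ / 36 - 4 * C) + 1)) ≤ β)
    {b : ℕ} (hb : 1 ≤ b) (hbC : Real.log b ≤ C * β) :
    (2 * (b : ℝ)) ^ 4 * 6 * (2 : ℝ) ^ n *
        (6 * Real.exp (-(β * E₀) / (6 : ℝ) ^ 2 + (n : ℝ) * (K₀ + D₁ * Real.log β) / 6)) ≤ δ := by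
  set η : ℝ := E₀ / 36 - 4 * C with hη
  set a : ℝ := (n : ℝ) * D₁ / 6 with ha
  set M : ℝ := 2 * a / η + 1 with hMdef
  have hηpos : 0 < η := by rw [hη]; linarith
  have ha0 : 0 ≤ a := by positivity
  have h2aη : (0 : ℝ) ≤ 2 * a / η := by positivity
  have hM1 : 1 ≤ M := by rw [hMdef]; linarith
  have hM0 : 0 < M := by linarith
  have hβ0 : 0 < β := by linarith
  -- `log β ≤ β / M + log M` (from `log (β/M) ≤ β/M - 1`)
  have hlog : Real.log β ≤ β / M + Real.log M := by
    have h1 := Real.log_le_sub_one_of_pos (div_pos hβ0 hM0)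
    rw [Real.log_div hβ0.ne' hM0.ne'] at h1
    linarith
  -- `a / M ≤ η / 2`
  have haM : a / M ≤ η / 2 := by
    rw [div_le_iff₀ hM0, hMdef]
    have : a = η / 2 * (2 * a / η) := by field_simp
    nlinarith [this, hηpos, ha0]
  -- the mesh factor
  have hb4 : (2 * (b : ℝ)) ^ 4 ≤ 16 * Real.exp (4 * C * β) := two_mul_pow_four_le hb hbC
  -- the exponent
  have hexp : 4 * C * β + (-(β * E₀) / (6 : ℝ) ^ 2 + (n : ℝ) * (K₀ + D₁ * Real.log β) / 6) ≤
      -(η / 2) * β + ((n : ℝ) * K₀ / 6 + a * Real.log M) := by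
    have h1 : (n : ℝ) * (K₀ + D₁ * Real.log β) / 6 = (n : ℝ) * K₀ / 6 + a * Real.log β := by rw [ha]; ring
    have h2 : a * Real.log β ≤ a * (β / M) + a * Real.log M := by nlinarith [hlog, ha0]
    have h3 : a * (β / M) ≤ η / 2 * β := by
      have : a * (β / M) = a / M * β := by ring
      rw [this]; exact mul_le_mul_of_nonneg_right haM hβ0.le
    have h4 : 4 * C * β + -(β * E₀) / (6 : ℝ) ^ 2 = -η * β := by rw [hη]; ring
    nlinarith [h1, h2, h3, h4]
  -- the threshold: `96 · 2^n · 6 · exp(nK₀/6 + a log M) · e^{-ηβ/2} ≤ δ`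
  have hconst : 0 < 96 * (2 : ℝ) ^ n * 6 / δ := by positivity
  have hthr : Real.log (96 * (2 : ℝ) ^ n * 6 / δ) + ((n : ℝ) * K₀ / 6 + a * Real.log M) ≤ η / 2 * β := by
    have h' := mul_le_mul_of_nonneg_left hβ (by positivity : (0 : ℝ) ≤ η / 2)
    have : η / 2 * (2 / η * (Real.log (96 * (2 : ℝ) ^ n * 6 / δ) + (n : ℝ) * K₀ / 6 + a * Real.log M)) =
        Real.log (96 * (2 : ℝ) ^ n * 6 / δ) + (n : ℝ) * K₀ / 6 + a * Real.log M := by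
      field_simp
    linarith
  calc (2 * (b : ℝ)) ^ 4 * 6 * (2 : ℝ) ^ n *
        (6 * Real.exp (-(β * E₀) / (6 : ℝ) ^ 2 + (n : ℝ) * (K₀ + D₁ * Real.log β) / 6))
      ≤ 16 * Real.exp (4 * C * β) * 6 * (2 : ℝ) ^ n *
        (6 * Real.exp (-(β * E₀) / (6 : ℝ) ^ 2 + (n : ℝ) * (K₀ + D₁ * Real.log β) / 6)) := by gcongr
    _ = 96 * (2 : ℝ) ^ n * 6 * (Real.exp (4 * C * β) *
        Real.exp (-(β * E₀) / (6 : ℝ) ^ 2 + (n : ℝ) * (K₀ + D₁ * Real.log β) / 6)) := by ring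
    _ = 96 * (2 : ℝ) ^ n * 6 *
        Real.exp (4 * C * β + (-(β * E₀) / (6 : ℝ) ^ 2 + (n : ℝ) * (K₀ + D₁ * Real.log β) / 6)) := by
        rw [← Real.exp_add]
    _ ≤ 96 * (2 : ℝ) ^ n * 6 * Real.exp (-(η / 2) * β + ((n : ℝ) * K₀ / 6 + a * Real.log M)) := by gcongr
    _ ≤ δ := by
        have hδ' : 96 * (2 : ℝ) ^ n * 6 = δ * Real.exp (Real.log (96 * (2 : ℝ) ^ n * 6 / δ)) := by
          rw [Real.exp_log hconst]; field_simp
        rw [hδ', mul_assoc, ← Real.exp_add]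
        have h0 : Real.log (96 * (2 : ℝ) ^ n * 6 / δ) + (-(η / 2) * β + ((n : ℝ) * K₀ / 6 + a * Real.log M)) ≤ 0 := by
          linarith
        calc δ * Real.exp (Real.log (96 * (2 : ℝ) ^ n * 6 / δ) + (-(η / 2) * β + ((n : ℝ) * K₀ / 6 + a * Real.log M)))
            ≤ δ * Real.exp 0 := by gcongr
          _ = δ := by simp

/-- **Clause (iii) for the excess-sparse factor at the note's scales, eventually below every budget.**  For every
lattice representation `r`, radius `R₀`, growth rate `C` and budget `E₀ ≥ 0` with `144 C < E₀`: for every `δ > 0`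
there is `β₂ ≥ 1` such that for all `β ≥ β₂`, all meshes `b ≥ 1` with `log b ≤ C β`, all thresholds `t₀ ≥ 0`, every
mesh-`b` grid `w`, every odd torus `2S+1 ≥ 4b` and every finite `F` inside `[-S, S]⁴`,
`μ_{2S+1,β} {V | ∀ c ∈ F, torusLift V ∉ typExcessSparse r.ρ w t₀ R₀ E₀ c} ≤ ofReal (δ ^ #F)`. -/
theorem torusAnchor_typExcessSparse_eventually (r : LatticeRep G) (R₀ : ℕ) {C E₀ : ℝ} (hE₀ : 0 ≤ E₀)
    (hE : 144 * C < E₀) :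
    ∀ δ : ℝ, 0 < δ → ∃ β₂ : ℝ, 1 ≤ β₂ ∧ ∀ β : ℝ, β₂ ≤ β →
      ∀ b : ℕ, 1 ≤ b → Real.log b ≤ C * β → ∀ t₀ : ℝ, 0 ≤ t₀ →
        ∀ w : Fin 4 → ℤ → ℤ,
          (∀ i j, w i j + ((b : ℕ) : ℤ) ≤ w i (j + 1) ∧ w i (j + 1) ≤ w i j + 2 * ((b : ℕ) : ℤ)) →
            ∀ S : ℕ, 4 * b ≤ 2 * S + 1 → ∀ F : Finset (Fin 4 → ℤ),
              (∀ c ∈ F, ∀ i, -(S : ℤ) ≤ w i (c i) ∧ w i (c i + 1) ≤ (S : ℤ) + 1) →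
                (wilsonMeasure (d := 4) (L := 2 * S + 1) r.ρ β)
                    {V : GaugeConfig 4 (2 * S + 1) G | ∀ c ∈ F, torusLift (2 * S + 1) V ∉
                      typExcessSparse r.ρ w t₀ R₀ E₀ c} ≤
                  ENNReal.ofReal (δ ^ #F) := by
  classical
  obtain ⟨K₀, D₁, h⟩ := torusAnchor_typExcessSparse (G := G) r
  intro δ hδ
  set n : ℕ := (4 * R₀ + 1) ^ 4 * 6 with hn
  refine ⟨max 1 ((2 / (E₀ / 36 - 4 * C)) * (Real.log (96 * (2 : ℝ) ^ n * 6 / δ) + (n : ℝ) * K₀ / 6 +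
      (n : ℝ) * D₁ / 6 * Real.log (2 * ((n : ℝ) * D₁ / 6) / (E₀ / 36 - 4 * C) + 1))), le_max_left _ _,
    fun β hβ b hb hbC t₀ ht₀ w hw S hS F hin => ?_⟩
  have hβ1 : 1 ≤ β := (le_max_left _ _).trans hβ
  have hβ' := (le_max_right _ _).trans hβ
  have hmain := h β hβ1 β (by linarith) le_rfl b hb t₀ ht₀ R₀ E₀ hE₀ w hw S hS F hin
  refine hmain.trans (ENNReal.ofReal_le_ofReal (pow_le_pow_left₀ (by positivity) ?_ _))
  simp only [card_orient_four]
  push_cast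
  have := excess_budget_le K₀ D₁ n hE hδ hβ1 hβ' hb hbC
  rw [hn] at this
  push_cast at this
  refine Eq.trans_le ?_ this
  ring

/-! ### §3 The excess-sparse factor composed with sup-`ζ`-rare factors -/

/-- **Clause (iii) for `typExcessSparse ∩ Typ₂` with budget `δ_xs + δ₂`** (`Typ₂` cell-local measurable with single-cell
sup-`ζ` kernel rarity `δ₂`, e.g. a finite intersection of bulk factors): the mixed torus upgrade fed with the torus
anchor of the excess-sparse factor. -/
theorem torusJointRarity_typExcessSparse_inter [SecondCountableTopology G] (r : LatticeRep G) :
    ∃ K₀ : ℝ, ∃ D₁ : ℕ, ∀ (β : ℝ), 1 ≤ β → ∀ (lam : ℝ), 0 ≤ lam → lam ≤ β → ∀ (b : ℕ), 1 ≤ b →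
      ∀ (t₀ : ℝ), 0 ≤ t₀ → ∀ (R : ℕ) (E₀ : ℝ), 0 ≤ E₀ → ∀ (w : Fin 4 → ℤ → ℤ),
        (∀ i j, w i j + ((b : ℕ) : ℤ) ≤ w i (j + 1) ∧ w i (j + 1) ≤ w i j + 2 * ((b : ℕ) : ℤ)) →
          ∀ (Typ₂ : (Fin 4 → ℤ) → Set (LGConfig 4 G)), (∀ c, MeasurableSet (Typ₂ c)) →
            (∀ c, DependsOn (fun σ : LGConfig 4 G => σ ∈ Typ₂ c) ↑(cellEdges w c)) →
              ∀ (δ₂ : ℝ), 0 ≤ δ₂ →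
                (∀ (c : Fin 4 → ℤ) (ζ : LGConfig 4 G),
                  (ymSpecification r.ρ β (regionEdges w {c}) ζ) (Typ₂ c)ᶜ ≤ ENNReal.ofReal δ₂) →
                  ∀ S : ℕ, 4 * b ≤ 2 * S + 1 → ∀ F : Finset (Fin 4 → ℤ), F.Nonempty →
                    (∀ c ∈ F, ∀ i, -(S : ℤ) ≤ w i (c i) ∧ w i (c i + 1) ≤ (S : ℤ) + 1) →
                      (wilsonMeasure (d := 4) (L := 2 * S + 1) r.ρ β)
                          {V : GaugeConfig 4 (2 * S + 1) G | ∀ c ∈ F, torusLift (2 * S + 1) V ∉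
                            typExcessSparse r.ρ w t₀ R E₀ c ∩ Typ₂ c} ≤
                        ENNReal.ofReal
                          ((((((2 * b) ^ 4 * Fintype.card (Orient 4) : ℕ) : ℝ) *
                                (2 : ℝ) ^ ((4 * R + 1) ^ 4 * Fintype.card (Orient 4)) *
                              ((Fintype.card (Orient 4) : ℝ) *
                                Real.exp (-(lam * E₀) / (Fintype.card (Orient 4) : ℝ) ^ 2 +
                                  (((4 * R + 1) ^ 4 * Fintype.card (Orient 4) : ℕ) : ℝ) * (K₀ + D₁ * Real.log β) /
                                    Fintype.card (Orient 4))) +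
                            δ₂) ^ F.card)) := by
  obtain ⟨K₀, D₁, h⟩ := torusAnchor_typExcessSparse (G := G) r
  refine ⟨K₀, D₁, fun β hβ lam hlam hlamβ b hb t₀ ht₀ R E₀ hE₀ w hw Typ₂ hTm₂ hTd₂ δ₂ hδ₂ h₂ => ?_⟩
  exact IRRarityUpgrade.torusJointRarity_inter r.ρ r.continuous β hb hw
    (measurableSet_typExcessSparse r.ρ r.continuous w t₀ R E₀) (typExcessSparse_dependsOn r.ρ w t₀ R E₀) hTm₂ hTd₂
    (by positivity) hδ₂ (fun S hS F hin => h β hβ lam hlam hlamβ b hb t₀ ht₀ R E₀ hE₀ w hw S hS F hin) h₂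

end Summit.QuantumFields.YangMills.Theorems.OddTorusChessboard

end
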